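import Mathlib
import Literature.NumberTheory.GaloisRepresentations.GaloisRep
import HarnessLib

/-!
# `P`-ordinary Hecke data for `GL₂` over a number field: the interface, with dimension-2 determinants

Interface ("hypothesis structure") for the localised ordinary Hecke algebra `𝕋 = 𝕋^{S,ord}(Kᵖ)_𝔪`
of `GL₂` over a number field `F` at a prime `p` with its Galois determinant — the *`P`-ordinary
Hecke algebra* of Caraiani–Newton ([CaraianiNewton2023, §2.2], there for the Siegel parabolic of
`U(n,n)`; for `GL₂/F` the parabolic at `v ∣ p` is the Borel or all of `GL₂`: Hida's (nearly)
ordinary part is taken at a chosen set `ordPlaces` of places above `p` and nothing is imposed at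
the others), `𝕋^{S,ord}(Kᵖ)` of [KhareThorne2017, §§2–4] (ordinary completed cohomology), and over
totally real fields `𝕋_∞(U,𝒪)_𝔪` of [SkinnerWiles1999, §3].  Requested by route
`Langlands/EisensteinDefectOne` (item `DefectOneSkinnerWiles`, planned split `ProModularNicePrimes`).

## What is here

* `PseudoRep2 G A`: **two-dimensional determinants** (Chenevier) of a group `G` with values in a
  commutative ring `A`, in the trace–determinant form valid in dimension `2` in all characteristics:
  `(T, D)`, `D : G →* Aˣ`, `T(1) = 2`, `T(gh) = T(hg)`, `D(g)T(g⁻¹h) − T(g)T(h) + T(gh) = 0`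
  [Chenevier2014, §1.2].  PROVED API: `ofRep` (`(tr ρ, det ρ)` of `ρ : G →* GL₂(A)`, by
  Cayley–Hamilton), `ofCharacters` (`χ₁ ⊕ χ₂`), `map`, `comp`, `charpoly`, `det_mul_trace_inv`,
  `trace_mul_self`, and for `Γ_K` the predicates `IsUnramifiedAt v`, `HasFrobCharpolyAt v P` in the
  conventions of `GaloisRep.IsUnramifiedAt` / `HasFrobCharpolyAt` (`v.primesAbove`, `Ideal.inertia`,
  **arithmetic** Frobenius `IsArithFrobAt`), with `isUnramifiedAt_ofRep`, `hasFrobCharpolyAt_ofRep`.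
  Determinants, not representations, are forced: at an Eisenstein maximal ideal the Hecke algebra
  carries no `GL₂`-valued representation in general, and over an imaginary quadratic field Wiles'
  `(a, d, x)` pseudo-representations (which use a complex conjugation, [SkinnerWiles1999, §2.4]) are
  unavailable.
* `POrdinaryHeckeAlgebraGL2 F p S Λ`: the INTERFACE — a carrier `T` (commutative topological ring,
  local, Noetherian, `p ∈ 𝔪_T`, `𝔪_T`-adic, complete), an algebra structure over a coefficient
  ("weight") ring `Λ` with `T` module-finite over `Λ`, a continuous `T`-valued determinant
  `galoisRep` of `Γ_F` unramified at `v ∉ S`, `v ∤ p`, a set `ordPlaces` of places above `p` with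
  two continuous characters `ordChar₁ ordChar₂` of each `Γ_{F_v}` splitting the local determinant,
  and density of the `Λ`-algebra generated by traces, determinants and local characters.  Derived:
  `residualRep`, `IsEisenstein ι χ̄₁ χ̄₂` (residual determinant `= χ̄₁ ⊕ χ̄₂`: the Eisenstein
  maximal ideal `𝔪_{χ̄₁,χ̄₂}`), `IsProModularPrime` ([SkinnerWiles1999, §4.1 (4.1)]) and
  `IsProModularPrime.of_le`, `.exists_trace_eq`.

## What each field transcribes, and what is NOT claimed (read before instantiating)

NO instance is constructed and NO existence fact is stated: the cohomology of the locally symmetric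
spaces of `GL₂/F`, completed cohomology and Hida's idempotent are not in the tree (separate requests
`CompletedCohomology`, `IsProModular`), so statements quantify over `(H : POrdinaryHeckeAlgebraGL2 F p
S Λ)` and every field is a HYPOTHESIS on `H`.  For the genuine `𝕋^{S,ord}(Kᵖ)_𝔪`:
* local / Noetherian / complete / finite over `Λ` (the Iwasawa algebra of the diamond operators):
  Hida's finiteness of the nearly ordinary Hecke algebra of `GL₂` over a number field (Hida, Duke
  Math. J. 69 (1993); Ann. Inst. Fourier 44 (1994)); [SkinnerWiles1999, Lemma 3.10] (totally real
  `F`; there also `Λ_𝒪`-torsion-free, which is NOT assumed here and not known when `F` has a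
  complex place); [KhareThorne2017, §§2–4].
* `galoisRep`, `isUnramifiedAt`: [Scholze2015, Thm. V.4.1] (an `n`-dimensional continuous
  determinant of `G_{F,S}` valued in `𝕋_{F,S}(K,ξ,i,m)/I`, `I^N = 0`, `N = N([F:ℚ], n)`, with
  `D(1 − X·Frob_v) = P_v(X)`, `v ∉ S`; the exponent bound survives ordinary parts and the limit over
  levels); [CaraianiNewton2023, Prop. 5.5.2] for `PGL₂`.  The interface wants a determinant valued
  in `T` itself: instantiate with `T = 𝕋_𝔪/J`, `J` nilpotent (same spectrum).  FROBENIUS: the tree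
  uses ARITHMETIC Frobenius; [CaraianiNewton2023, §1.5, (2.1.5)] uses geometric Frobenius, so its
  `T_{v,1}` is the trace of the inverse of an arithmetic Frobenius, `= T_{v,1}(q_v T_{v,2})⁻¹` here
  (`det_mul_trace_inv`).  Hecke operators are not separate data: `T_v, S_v` are Frobenius
  coefficients of `galoisRep.charpoly`, generating `T` topologically together with `Λ` and the
  operators at `p` ([SkinnerWiles1999, Lemma 3.11]; field `dense_adjoin`).
* `ordChar₁`, `ordChar₂`, `comp_toLocal` (`P`-ordinary local–global compatibility at
  `v ∈ ordPlaces`): over totally real `F`, [SkinnerWiles1999, (3.2), (3.4)(vi)]; over CM `F` PROVED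
  ONLY for NON-EISENSTEIN decomposed-generic `𝔪` under conditions on `p`, `F`
  [CaraianiNewton2023, Thm. 4.2.15 (1)–(3)] — at an Eisenstein `𝔪` over an imaginary quadratic field
  it is an open hypothesis carried by whoever instantiates.  A determinant cannot tell the sub from
  the quotient character; the names only fix bookkeeping (`ordChar₂` is meant to carry the
  `U_v`-eigenvalue on Frobenius, `Art_v(ϖ_v)` = geometric Frobenius in [CaraianiNewton2023, §1.5]).
  "`Λ`-structure `= ordCharᵢ ∘ Art_v` on `𝒪_vˣ`" is NOT a field (no Artin map for
  `v.adicCompletion F` in the tree); add it as a hypothesis where needed.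
* Not here: Hida's control/classicality theorems (need the cohomology), the cuspidal / boundary
  variants of `𝕋`, reducedness of `𝕋`.

## References

* [Chenevier2014] G. Chenevier, LMS LNS 414 (2014) (arXiv:0809.0415), §1.2 (Example "Determinants
  of dimension 2 on a group" and the Lemma following it), §1.4 (kernel), §2.5 (continuity).
* [Scholze2015] P. Scholze, Ann. of Math. 182 (2015), Thm. V.4.1, Cor. V.4.3.
* [CaraianiNewton2023] A. Caraiani, J. Newton, arXiv:2301.10509v3, §1.5, §2.2, Prop. 5.5.2,
  Thm. 4.2.15.
* [KhareThorne2017] C. Khare, J. Thorne, Amer. J. Math. 139 (2017), §§2–4.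
* [SkinnerWiles1999] C. Skinner, A. Wiles, Publ. Math. IHÉS 89 (1999), §2.4, §3.3 (3.2)–(3.6),
  Lemmas 3.10–3.11, §4.1 (4.1).
-/

noncomputable section

open scoped NumberField Polynomial
open Field IsDedekindDomain Polynomial

namespace Literature.NumberTheory.Automorphic

open Literature.NumberTheory.GaloisRepresentations

universe u v w

/-! ### Two-dimensional determinants (Chenevier), trace–determinant form -/

/-- A **two-dimensional determinant** (Chenevier) of the group `G` with values in the commutative
ring `A`, presented as a pair `(T, D) = (trace, det)`: `D : G →* Aˣ` a character, `T : G → A` with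
`T(1) = 2`, `T(gh) = T(hg)` and Chenevier's identity `D(g) T(g⁻¹h) − T(g) T(h) + T(gh) = 0`.  By
[Chenevier2014, §1.2] such pairs are exactly the `A`-valued determinants of `G` of dimension `2`
(in every characteristic; when `2 ∈ Aˣ` they are also the same as Taylor–Rouquier pseudocharacters
of dimension `2`, `D(g) = (T(g)² − T(g²))/2`).
[cite: Chenevier2014, §1.2, Example "Determinants of dimension 2 on a group" and the Lemma following it] -/
@[ext]
structure PseudoRep2 (G : Type u) (A : Type v) [Group G] [CommRing A] where
  /-- The trace `T : G → A`. -/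
  trace : G → A
  /-- The determinant character `D : G →* Aˣ`. -/
  det : G →* Aˣ
  /-- `T(1) = 2`. -/
  trace_one : trace 1 = 2
  /-- `T` is central: `T(gh) = T(hg)`. -/
  trace_mul_comm : ∀ g h, trace (g * h) = trace (h * g)
  /-- Chenevier's identity `D(g) T(g⁻¹ h) − T(g) T(h) + T(g h) = 0`. -/
  det_mul_trace_inv_mul :
    ∀ g h, (det g : A) * trace (g⁻¹ * h) - trace g * trace h + trace (g * h) = 0

namespace PseudoRep2

variable {G : Type u} {A : Type v} {B : Type w} [Group G] [CommRing A] [CommRing B]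

/-- `D(g) T(g⁻¹) = T(g)` (the identity at `h = 1`). [cite: Chenevier2014, §1.2] -/
theorem det_mul_trace_inv (D : PseudoRep2 G A) (g : G) :
    (D.det g : A) * D.trace g⁻¹ = D.trace g := by
  have h := D.det_mul_trace_inv_mul g 1
  rw [mul_one, mul_one, D.trace_one] at h
  linear_combination h

/-- `T(g²) = T(g)² − 2 D(g)` (the identity at `h = g`: Cayley–Hamilton for the trace).
[cite: Chenevier2014, §1.2] -/
theorem trace_mul_self (D : PseudoRep2 G A) (g : G) :
    D.trace (g * g) = D.trace g ^ 2 - 2 * (D.det g : A) := by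
  have h := D.det_mul_trace_inv_mul g g
  rw [inv_mul_cancel, D.trace_one] at h
  linear_combination h

/-- The characteristic polynomial `X² − T(g) X + D(g)` of `g`. [cite: Chenevier2014, §1.3] -/
def charpoly (D : PseudoRep2 G A) (g : G) : A[X] :=
  X ^ 2 - C (D.trace g) * X + C (D.det g : A)

/-- Change of coefficients along a ring homomorphism `f : A →+* B`. [cite: Chenevier2014, §1.2] -/
def map (D : PseudoRep2 G A) (f : A →+* B) : PseudoRep2 G B where
  trace := f ∘ D.trace
  det := (Units.map (f : A →* B)).comp D.det
  trace_one := by simp [D.trace_one, map_ofNat f 2]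
  trace_mul_comm g h := by simp [D.trace_mul_comm g h]
  det_mul_trace_inv_mul g h := by
    simpa using congrArg f (D.det_mul_trace_inv_mul g h)

/-- Unfolding lemma: the trace of `D.map f`. [folklore] -/
@[simp] lemma map_trace (D : PseudoRep2 G A) (f : A →+* B) (g : G) :
    (D.map f).trace g = f (D.trace g) := rfl

/-- Unfolding lemma: the determinant of `D.map f`. [folklore] -/
@[simp] lemma map_det (D : PseudoRep2 G A) (f : A →+* B) (g : G) :
    ((D.map f).det g : B) = f (D.det g) := rfl

/-- `map` is functorial. [folklore] -/
lemma map_map {B' : Type*} [CommRing B'] (D : PseudoRep2 G A) (f : A →+* B) (f' : B →+* B') :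
    (D.map f).map f' = D.map (f'.comp f) := by
  refine PseudoRep2.ext (funext fun g => rfl) (MonoidHom.ext fun g => Units.ext ?_)
  rfl

/-- Restriction along a group homomorphism `φ : H →* G` (e.g. to a decomposition group).
[cite: Chenevier2014, §1.2] -/
def comp {H : Type*} [Group H] (D : PseudoRep2 G A) (φ : H →* G) : PseudoRep2 H A where
  trace := D.trace ∘ φ
  det := D.det.comp φ
  trace_one := by simp [D.trace_one]
  trace_mul_comm g h := by simp [D.trace_mul_comm]
  det_mul_trace_inv_mul g h := by
    simpa [map_mul, map_inv] using D.det_mul_trace_inv_mul (φ g) (φ h)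

/-- Unfolding lemma: the trace of `D.comp φ`. [folklore] -/
@[simp] lemma comp_trace {H : Type*} [Group H] (D : PseudoRep2 G A) (φ : H →* G) (h : H) :
    (D.comp φ).trace h = D.trace (φ h) := rfl

/-- Unfolding lemma: the determinant of `D.comp φ`. [folklore] -/
@[simp] lemma comp_det {H : Type*} [Group H] (D : PseudoRep2 G A) (φ : H →* G) (h : H) :
    (D.comp φ).det h = D.det (φ h) := rfl

/-- The determinant `χ₁ ⊕ χ₂` of the sum of two characters: `T = χ₁ + χ₂`, `D = χ₁ χ₂`.
[cite: Chenevier2014, §1.2] -/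
def ofCharacters (χ₁ χ₂ : G →* Aˣ) : PseudoRep2 G A where
  trace g := (χ₁ g : A) + χ₂ g
  det := χ₁ * χ₂
  trace_one := by simp; norm_num
  trace_mul_comm g h := by simp [map_mul, mul_comm]
  det_mul_trace_inv_mul g h := by
    have h1 : (χ₁ g : A) * ↑(χ₁ g)⁻¹ = 1 := Units.mul_inv _
    have h2 : (χ₂ g : A) * ↑(χ₂ g)⁻¹ = 1 := Units.mul_inv _
    simp only [MonoidHom.mul_apply, map_mul, map_inv, Units.val_mul]
    linear_combination ((χ₂ g : A) * ↑(χ₁ h)) * h1 + ((χ₁ g : A) * ↑(χ₂ h)) * h2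

/-- Unfolding lemma: the trace of `χ₁ ⊕ χ₂` is `χ₁ + χ₂`. [folklore] -/
@[simp] lemma ofCharacters_trace (χ₁ χ₂ : G →* Aˣ) (g : G) :
    (ofCharacters χ₁ χ₂).trace g = χ₁ g + χ₂ g := rfl

/-- Unfolding lemma: the determinant of `χ₁ ⊕ χ₂` is `χ₁ χ₂`. [folklore] -/
@[simp] lemma ofCharacters_det (χ₁ χ₂ : G →* Aˣ) (g : G) :
    (ofCharacters χ₁ χ₂).det g = χ₁ g * χ₂ g := rfl

/-- `map` of a sum of characters is the sum of the mapped characters. [folklore] -/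
lemma ofCharacters_map (χ₁ χ₂ : G →* Aˣ) (f : A →+* B) :
    (ofCharacters χ₁ χ₂).map f =
      ofCharacters ((Units.map (f : A →* B)).comp χ₁) ((Units.map (f : A →* B)).comp χ₂) := by
  refine PseudoRep2.ext (funext fun g => ?_) (MonoidHom.ext fun g => Units.ext ?_)
  · simp
  · simp

/-- The determinant `(tr ρ, det ρ)` of a genuine representation `ρ : G →* GL₂(A)`; Chenevier's
identity is Cayley–Hamilton: `det(M)·M⁻¹ = adj(M) = tr(M)·1 − M`.
[cite: Chenevier2014, §1.2, Example "Determinants of dimension 2 on a group"] -/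
def ofRep (ρ : G →* GL (Fin 2) A) : PseudoRep2 G A where
  trace g := ((ρ g : GL (Fin 2) A) : Matrix (Fin 2) (Fin 2) A).trace
  det := Matrix.GeneralLinearGroup.det.comp ρ
  trace_one := by
    simp only [map_one, Units.val_one, Matrix.trace_fin_two, Matrix.one_apply_eq]
    norm_num
  trace_mul_comm g h := by
    simp only [map_mul, Units.val_mul]
    exact Matrix.trace_mul_comm _ _
  det_mul_trace_inv_mul g h := by
    have key : ((Matrix.GeneralLinearGroup.det.comp ρ g : Aˣ) : A) *
        ((ρ (g⁻¹ * h) : GL (Fin 2) A) : Matrix (Fin 2) (Fin 2) A).trace =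
        ((ρ g : Matrix (Fin 2) (Fin 2) A).adjugate * (ρ h : Matrix (Fin 2) (Fin 2) A)).trace := by
      rw [map_mul, map_inv, Units.val_mul, Matrix.coe_units_inv, Matrix.inv_def, Matrix.smul_mul,
        Matrix.trace_smul, smul_eq_mul, ← mul_assoc, MonoidHom.comp_apply,
        Matrix.GeneralLinearGroup.val_det_apply,
        Ring.mul_inverse_cancel _ (Matrix.isUnits_det_units _), one_mul]
    rw [key]
    simp only [Matrix.trace_fin_two, Matrix.mul_apply, Fin.sum_univ_two, Matrix.adjugate_fin_two,
      Matrix.of_apply, Matrix.cons_val', Matrix.cons_val_zero, Matrix.cons_val_one,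
      Matrix.empty_val', Matrix.cons_val_fin_one, Units.val_mul, map_mul]
    ring

/-- Unfolding lemma: the trace of `ofRep ρ` is the matrix trace. [folklore] -/
@[simp] lemma ofRep_trace (ρ : G →* GL (Fin 2) A) (g : G) :
    (ofRep ρ).trace g = ((ρ g : GL (Fin 2) A) : Matrix (Fin 2) (Fin 2) A).trace := rfl

/-- Unfolding lemma: the determinant of `ofRep ρ` is the matrix determinant. [folklore] -/
@[simp] lemma ofRep_det (ρ : G →* GL (Fin 2) A) (g : G) :
    ((ofRep ρ).det g : A) = ((ρ g : GL (Fin 2) A) : Matrix (Fin 2) (Fin 2) A).det := rfl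

/-- The characteristic polynomial of `ofRep ρ` at `g` is the matrix characteristic polynomial of
`ρ g` (Mathlib `Matrix.charpoly_fin_two`). [folklore] -/
lemma charpoly_ofRep [Nontrivial A] (ρ : G →* GL (Fin 2) A) (g : G) :
    (ofRep ρ).charpoly g = ((ρ g : GL (Fin 2) A) : Matrix (Fin 2) (Fin 2) A).charpoly := by
  rw [Matrix.charpoly_fin_two]
  rfl

/-- Continuity of a determinant with values in a topological ring: trace and determinant are
continuous maps `G → A` ([Chenevier2014, §2.5]: a determinant is continuous iff its coefficients
`Λ_i : G → A`, `i ≤ d`, are). [cite: Chenevier2014, §2.5] -/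
structure IsContinuous [TopologicalSpace G] [TopologicalSpace A] (D : PseudoRep2 G A) : Prop where
  /-- the trace is continuous -/
  continuous_trace : Continuous D.trace
  /-- the determinant character is continuous (as an `A`-valued map) -/
  continuous_det : Continuous fun g => (D.det g : A)

/-! ### Determinants of absolute Galois groups: ramification and Frobenius (tree conventions) -/

section Galois

variable {K : Type u} [Field K]

/-- A determinant `D` of `Γ_K` is **unramified at the prime `𝔓`** of `\bar ℤ_K = absIntegers (𝓞 K) K`
if the inertia group `I_𝔓` lies in its kernel: `T(σ g) = T(g)` and `D(σ) = 1` for `σ ∈ I_𝔓`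
(cf. `GaloisRep.IsUnramifiedAtPrime`; for determinants the kernel is Chenevier's `Ker`).
[cite: Chenevier2014, §1.4 (kernel of a determinant)] -/
def IsUnramifiedAtPrime (𝔓 : Ideal (absIntegers (𝓞 K) K))
    (D : PseudoRep2 (absoluteGaloisGroup K) A) : Prop :=
  ∀ σ ∈ 𝔓.inertia (absoluteGaloisGroup K), (∀ g, D.trace (σ * g) = D.trace g) ∧ D.det σ = 1

/-- `D` is **unramified at the finite place `v`** of `K`: unramified at every prime `𝔓 ∣ v` of
`\bar ℤ_K` (as `GaloisRep.IsUnramifiedAt`). [folklore] -/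
def IsUnramifiedAt (v : HeightOneSpectrum (𝓞 K)) (D : PseudoRep2 (absoluteGaloisGroup K) A) :
    Prop :=
  ∀ 𝔓 ∈ v.primesAbove, D.IsUnramifiedAtPrime 𝔓

/-- `D.HasFrobCharpolyAt v P`: every **arithmetic** Frobenius `σ` at every `𝔓 ∣ v` (Mathlib
`IsArithFrobAt (𝓞 K) σ 𝔓`) has `D.charpoly σ = P` — verbatim the convention of
`GaloisRep.HasFrobCharpolyAt` (sources using geometric Frobenius, e.g. [Scholze2015, V.4],
[CaraianiNewton2023, (2.1.5)], describe `D.charpoly σ⁻¹`). [folklore] -/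
def HasFrobCharpolyAt (v : HeightOneSpectrum (𝓞 K)) (P : A[X])
    (D : PseudoRep2 (absoluteGaloisGroup K) A) : Prop :=
  ∀ 𝔓 ∈ v.primesAbove, ∀ σ : absoluteGaloisGroup K, IsArithFrobAt (𝓞 K) σ 𝔓 → D.charpoly σ = P

variable [TopologicalSpace A]

/-- A framed Galois representation unramified at `v` has unramified determinant. [folklore] -/
theorem isUnramifiedAt_ofRep {v : HeightOneSpectrum (𝓞 K)} {ρ : FramedGaloisRep K A 2}
    (h : ρ.IsUnramifiedAt v) : (ofRep (ρ : absoluteGaloisGroup K →* GL (Fin 2) A)).IsUnramifiedAt v := by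
  intro 𝔓 h𝔓 σ hσ
  have h1 : ρ σ = 1 := h 𝔓 h𝔓 σ hσ
  refine ⟨fun g => ?_, Units.ext ?_⟩
  · simp [h1]
  · simp [h1]

/-- The Frobenius characteristic polynomials of `ρ` and of its determinant agree. [folklore] -/
theorem hasFrobCharpolyAt_ofRep [Nontrivial A] {v : HeightOneSpectrum (𝓞 K)} {P : A[X]}
    {ρ : FramedGaloisRep K A 2} (h : ρ.HasFrobCharpolyAt v P) :
    (ofRep (ρ : absoluteGaloisGroup K →* GL (Fin 2) A)).HasFrobCharpolyAt v P := by
  intro 𝔓 h𝔓 σ hσ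
  rw [charpoly_ofRep]
  exact h 𝔓 h𝔓 σ hσ

end Galois

end PseudoRep2

/-! ### The interface -/

/-- **`P`-ordinary Hecke datum for `GL₂/F` at `p`** (interface for the localised ordinary Hecke
algebra `𝕋^{S,ord}(Kᵖ)_𝔪` with its Galois determinant; see the module docstring for what each
field transcribes and for what is NOT claimed).  Parameters: the number field `F`, the prime `p`,
the set `S` of bad places away from `p`, and the coefficient/weight ring `Λ` over which `T` is
finite (the Iwasawa algebra of the diamond operators in the intended instance).  No instance is
constructed in the tree; statements quantify over such data.
[cite: CaraianiNewton2023, §2.2 and Prop. 5.5.2] [cite: SkinnerWiles1999, §3.3 (3.5) and Lemmas 3.10–3.11] -/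
structure POrdinaryHeckeAlgebraGL2 (F : Type) [Field F] [NumberField F] (p : ℕ)
    (S : Set (HeightOneSpectrum (𝓞 F))) (Λ : Type) [CommRing Λ] [TopologicalSpace Λ] where
  /-- The carrier: the localised Hecke algebra `T = 𝕋_𝔪` (or `𝕋_𝔪/J`, `J` nilpotent). -/
  T : Type
  [commRing : CommRing T]
  [topologicalSpace : TopologicalSpace T]
  [isTopologicalRing : IsTopologicalRing T]
  [isLocalRing : IsLocalRing T]
  [isNoetherianRing : IsNoetherianRing T]
  [algebra : Algebra Λ T]
  /-- residue characteristic `p`: `p ∈ 𝔪_T` -/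
  natCast_mem_maximalIdeal : (p : T) ∈ IsLocalRing.maximalIdeal T
  /-- the topology of `T` is the `𝔪_T`-adic topology -/
  isAdic : IsAdic (IsLocalRing.maximalIdeal T)
  /-- `T` is `𝔪_T`-adically complete -/
  isAdicComplete : IsAdicComplete (IsLocalRing.maximalIdeal T) T
  /-- the structure map `Λ → T` is continuous -/
  continuous_algebraMap : Continuous (algebraMap Λ T)
  /-- Hida finiteness: `T` is a finite `Λ`-module -/
  moduleFinite : Module.Finite Λ T
  /-- the Galois determinant `D : Γ_F → T` of dimension `2` -/
  galoisRep : PseudoRep2 (absoluteGaloisGroup F) T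
  /-- `D` is continuous for the Krull topology on `Γ_F` -/
  isContinuous : galoisRep.IsContinuous
  /-- `D` is unramified at the places `v ∉ S` not above `p` -/
  isUnramifiedAt : ∀ v ∉ S, (p : 𝓞 F) ∉ v.asIdeal → galoisRep.IsUnramifiedAt v
  /-- the places above `p` at which the ordinary (`P = B`) condition is imposed -/
  ordPlaces : Set (HeightOneSpectrum (𝓞 F))
  /-- `ordPlaces` consists of places above `p` -/
  natCast_mem_asIdeal_of_mem_ordPlaces : ∀ v ∈ ordPlaces, (p : 𝓞 F) ∈ v.asIdeal
  /-- first universal character of `Γ_{F_v}`, `v ∈ ordPlaces` -/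
  ordChar₁ : (v : ordPlaces) → (absoluteGaloisGroup (v.1.adicCompletion F) →ₜ* Tˣ)
  /-- second universal character of `Γ_{F_v}` (the one meant to carry `U_v`), `v ∈ ordPlaces` -/
  ordChar₂ : (v : ordPlaces) → (absoluteGaloisGroup (v.1.adicCompletion F) →ₜ* Tˣ)
  /-- `P`-ordinary local–global compatibility: `D|_{Γ_{F_v}} = ordChar₁ v ⊕ ordChar₂ v` -/
  comp_toLocal : ∀ v : ordPlaces,
    galoisRep.comp (absGaloisRestrict F (v.1.adicCompletion F)).toMonoidHom =
      PseudoRep2.ofCharacters (ordChar₁ v).toMonoidHom (ordChar₂ v).toMonoidHom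
  /-- `T` is topologically generated over `Λ` by the traces and determinants of `D` and the values
  of the local characters (the Hecke operators `T_v, S_v, U_v`) -/
  dense_adjoin : Dense ((Algebra.adjoin Λ
    (Set.range galoisRep.trace ∪ Set.range (fun g => (galoisRep.det g : T)) ∪
      (⋃ v, Set.range fun σ => (ordChar₁ v σ : T)) ∪ ⋃ v, Set.range fun σ => (ordChar₂ v σ : T)) :
        Subalgebra Λ T) : Set T)

namespace POrdinaryHeckeAlgebraGL2

attribute [instance] commRing topologicalSpace isTopologicalRing isLocalRing isNoetherianRing
  algebra

variable {F : Type} [Field F] [NumberField F] {p : ℕ} {S : Set (HeightOneSpectrum (𝓞 F))}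
  {Λ : Type} [CommRing Λ] [TopologicalSpace Λ] (H : POrdinaryHeckeAlgebraGL2 F p S Λ)

/-- `T` is a finite `Λ`-module (field `moduleFinite`, registered as an instance). [folklore] -/
instance moduleFinite_T : Module.Finite Λ H.T := H.moduleFinite

/-- `P = B` at every place above `p`: the ordinary condition is imposed at all `v ∣ p` (the case of
Hida's nearly ordinary Hecke algebra, [SkinnerWiles1999, §3.2]; in general `ordPlaces` may be a
proper subset, [CaraianiNewton2023, §2.2, "fix a subset `S̄ ⊂ S̄_p`"]). [cite: CaraianiNewton2023, §2.2] -/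
def IsOrdinaryAbove (H : POrdinaryHeckeAlgebraGL2 F p S Λ) : Prop :=
  ∀ v : HeightOneSpectrum (𝓞 F), (p : 𝓞 F) ∈ v.asIdeal → v ∈ H.ordPlaces

/-- The residual determinant `D̄ : Γ_F → k(𝔪_T)` (the residual Hecke eigensystem of `𝔪`;
cf. [Scholze2015, Cor. V.4.3], [CaraianiNewton2023, Prop. 5.5.2] for `ρ̄_𝔪`). [folklore] -/
def residualRep : PseudoRep2 (absoluteGaloisGroup F) (IsLocalRing.ResidueField H.T) :=
  H.galoisRep.map (IsLocalRing.residue H.T)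

/-- Unfolding lemma: the residual trace is the trace modulo `𝔪_T`. [folklore] -/
@[simp] lemma residualRep_trace (g : absoluteGaloisGroup F) :
    H.residualRep.trace g = IsLocalRing.residue H.T (H.galoisRep.trace g) := rfl

/-- `𝔪_T` is **Eisenstein of type `(χ̄₁, χ̄₂)`**: after the embedding `ι` of the residue field
into a field `k`, the residual determinant is the sum `χ̄₁ ⊕ χ̄₂` of two `k`-valued characters
(`𝔪 = 𝔪_{χ̄₁,χ̄₂}`: `T_v ≡ χ̄₁(Frob_v) + χ̄₂(Frob_v)`; "permissible" maximal ideals of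
[SkinnerWiles1999, §3.3]; "Eisenstein" in [CaraianiNewton2023, Thm. 4.2.15 (2)] means residually
reducible). [cite: SkinnerWiles1999, §3.3 (permissible maximal ideals)] -/
def IsEisenstein {k : Type*} [Field k] (ι : IsLocalRing.ResidueField H.T →+* k)
    (χ₁ χ₂ : absoluteGaloisGroup F →* kˣ) : Prop :=
  H.residualRep.map ι = PseudoRep2.ofCharacters χ₁ χ₂

/-- Unfolding `IsEisenstein` on traces: `ι (T(g) mod 𝔪) = χ̄₁(g) + χ̄₂(g)`. [folklore] -/
lemma IsEisenstein.trace_eq {k : Type*} [Field k] {ι : IsLocalRing.ResidueField H.T →+* k}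
    {χ₁ χ₂ : absoluteGaloisGroup F →* kˣ} (h : H.IsEisenstein ι χ₁ χ₂) (g : absoluteGaloisGroup F) :
    ι (IsLocalRing.residue H.T (H.galoisRep.trace g)) = χ₁ g + χ₂ g := by
  have := congrArg (fun D : PseudoRep2 (absoluteGaloisGroup F) k => D.trace g) h
  simpa using this

/-- **Pro-modularity** (Skinner–Wiles) of a prime `q` of a ring `R` carrying a determinant `D_R`
of `Γ_F` (e.g. a nearly ordinary deformation ring with the determinant of its universal
deformation), relative to the Hecke datum `H`: there is a ring homomorphism `θ : T → R ⧸ q`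
carrying the Hecke determinant to `D_R mod q` — [SkinnerWiles1999, §4.1 (4.1)]: "`q` is pro-modular
if there is a homomorphism `θ_q : 𝕋_𝒟 → R_𝒟/q` such that `φ_q = θ_q ∘ π_𝒟`", `φ_q`, `π_𝒟` the
maps classifying the pseudo-deformations `ρ_𝒟 mod q` and `ρ^{mod}` (there all rings are complete
local Noetherian `𝒪`-algebras and the maps local, hence continuous; no topology is imposed on `θ`
here). [cite: SkinnerWiles1999, §4.1 (4.1)] -/
def IsProModularPrime {R : Type*} [CommRing R] (DR : PseudoRep2 (absoluteGaloisGroup F) R)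
    (q : Ideal R) : Prop :=
  ∃ θ : H.T →+* R ⧸ q, H.galoisRep.map θ = DR.map (Ideal.Quotient.mk q)

/-- Pro-modularity passes to larger ideals: "if `q` is a pro-modular prime of `R_𝒟` and `p ⊇ q` is
another prime ideal, then `p` is also pro-modular" [SkinnerWiles1999, §4.1].
[cite: SkinnerWiles1999, §4.1] -/
theorem IsProModularPrime.of_le {R : Type*} [CommRing R] {DR : PseudoRep2 (absoluteGaloisGroup F) R}
    {q q' : Ideal R} (h : H.IsProModularPrime DR q) (hle : q ≤ q') : H.IsProModularPrime DR q' := by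
  obtain ⟨θ, hθ⟩ := h
  refine ⟨(Ideal.Quotient.factor hle).comp θ, ?_⟩
  rw [← PseudoRep2.map_map, hθ, PseudoRep2.map_map, Ideal.Quotient.factor_comp_mk]

/-- Unfolding pro-modularity on traces: `θ(T(g)) = T_R(g) mod q` for all `g ∈ Γ_F` (in
[SkinnerWiles1999, §4.1]: "`θ_q(T(ℓ)) = trace ρ_𝒟(Frob_ℓ) mod q` for all `ℓ ∉ Σ`").
[cite: SkinnerWiles1999, §4.1] -/
theorem IsProModularPrime.exists_trace_eq {R : Type*} [CommRing R]
    {DR : PseudoRep2 (absoluteGaloisGroup F) R} {q : Ideal R} (h : H.IsProModularPrime DR q) :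
    ∃ θ : H.T →+* R ⧸ q, ∀ g, θ (H.galoisRep.trace g) = Ideal.Quotient.mk q (DR.trace g) := by
  obtain ⟨θ, hθ⟩ := h
  refine ⟨θ, fun g => ?_⟩
  have := congrArg (fun D : PseudoRep2 (absoluteGaloisGroup F) (R ⧸ q) => D.trace g) hθ
  simpa using this

end POrdinaryHeckeAlgebraGL2

end Literature.NumberTheory.Automorphic
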